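import Summits.AtomisticToContinuum.Crystallization.Theorems.CoarseGrains.Negative.PredicateAPI
import Summits.AtomisticToContinuum.Crystallization.Theorems.CoarseGrains.Negative.LoadBearing
import Summits.AtomisticToContinuum.Crystallization.Theorems.CoarseGrains.Negative.CubicThreshold

/-!
# `FineGrains` / Negative: minimality and largeness are load-bearing; thresholds; no `N₀` uniform in `ρ`

Negative knowledge for crux `stmt-AtomisticToContinuum-9330` (`ExcessDecayLiouville.FineGrains`: for all
`ρ, ε > 0`, every large Lennard-Jones ground state contains a closed ball `B_ρ(c)` two-way `ε`-matched
with an admissible affine hcp two-lattice with FREE sublattice translations), standing crux-disprover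
seat `refuter-cdisprove-stmt-AtomisticToContinuum-9330-0` (2026-08-16).  Builds on the sibling crux's
kit `Theorems/CoarseGrains/Negative/{PredicateAPI, LoadBearing, CubicThreshold}` (`Lam`/`Near`/`Adm` are
verbatim the `let`s of BOTH cruxes).  Nothing here closes an item; no theorem concludes a Theses decl.
The prose analysis of why the crux resists is in the work file `Cruxes/FineGrains/Disproof.lean`.

* `HasFineBall ρ ε x` = the matrix of the crux; `fineGrains_iff` is `Iff.rfl`; `near_mono` /
  `hasFineBall_mono` (antitone in `ρ`, monotone in `ε`).
* `exists_bond_of_near`: a matched ball of radius `≥ 21/10` at tolerance `ε < 189/400` forces two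
  distinct particles at distance in `[189/200 − 2ε, 199/200 + 2ε]`; `fineGrains_forces_bonds` (the crux
  implies bonds near the window `[0.945, 0.995]` in all large ground states).
* `fineGrains_false_without_minimality` (collinear gas, `(ρ, ε) = (3, 1/40)`; `not_near_gas` for
  `ρ ≥ 21/10`, `ε < 189/400`) and `fineGrains_false_without_largeness` (empty ground state, `ρ = 2`,
  any `ε`): any proof must use minimality AND largeness.
* `one_le_threshold` (`ρ ≥ 11/10 ⇒ N₀ ≥ 1`), `threshold_cubic` (`ε ≤ 1/40`, `ρ ≥ 11/10 + 4K ⇒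
  N₀ ≥ (K+1)³`), `not_fineGrains_uniform_radius` (`∃ N₀ ∀ ρ ε` is false), `not_hasFineBall_of_neg`
  (`ε < 0` is contradictory from `ρ ≥ 11/10`).
* `near_translate`, `near_swap`, `near_normalise`: the matching is invariant under lattice translates of
  the sublattice origins and under swapping the sublattices; a matched datum may be normalised to have
  both origins within `11/10` of the centre (bounded data, for compactness arguments).
-/

noncomputable section

open Literature.MathematicalPhysics.StatisticalMechanics

namespace Summit.AtomisticToContinuum.Crystallization.Theorems.FineGrains.Negative.LoadBearing

open Summit.AtomisticToContinuum.Crystallization.Theorems.CoarseGrains.Negative.PredicateAPI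
open Summit.AtomisticToContinuum.Crystallization.Theorems.CoarseGrains.Negative.LoadBearing
open Summit.AtomisticToContinuum.Crystallization.Theorems.CoarseGrains.Negative.CubicThreshold

/-! ## The crux unfolded -/

/-- The matrix of the crux for one configuration: `x` has a closed ball `B_ρ(c)` two-way `ε`-matched with
the sites `t m + A z` (`m : Fin 2`, `z ∈ Λ`) of an admissible datum (`Adm A`; NO inner-displacement
constraint on `t`, unlike `CoarseGrains`). -/
def HasFineBall (ρ ε : ℝ) {N : ℕ} (x : Fin N → E3) : Prop :=
  ∃ (c : E3) (t : Fin 2 → E3) (A : E3 →L[ℝ] E3), Adm A ∧ Near (Set.range x) c ρ t A ε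

/-- `FineGrains` is, definitionally, `∀ ρ ε > 0 ∃ N₀ ∀ N ≥ N₀ ∀ ground states x, HasFineBall ρ ε x`. -/
theorem fineGrains_iff :
    Theses.ExcessDecayLiouville.FineGrains ↔
    ∀ ρ ε : ℝ, 0 < ρ → 0 < ε → ∃ N₀ : ℕ, ∀ N : ℕ, N₀ ≤ N → ∀ x : Fin N → E3,
      IsGroundState lennardJones x → HasFineBall ρ ε x :=
  Iff.rfl

/-! ## Monotonicity: the matrix is antitone in the radius and monotone in the tolerance -/

/-- Two-way matching is antitone in the radius and monotone in the tolerance. [folklore] -/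
theorem near_mono {X : Set E3} {c : E3} {r r' ε ε' : ℝ} {t : Fin 2 → E3} {A : E3 →L[ℝ] E3}
    (hr : r' ≤ r) (hε : ε ≤ ε') (hN : Near X c r t A ε) : Near X c r' t A ε' :=
  ⟨fun p hp hpc => by
    obtain ⟨m, z, hz, hd⟩ := hN.1 p hp (hpc.trans hr)
    exact ⟨m, z, hz, hd.trans hε⟩,
   fun m z hz hzc => by
    obtain ⟨p, hp, hd⟩ := hN.2 m z hz (hzc.trans hr)
    exact ⟨p, hp, hd.trans hε⟩⟩

/-- The matrix is antitone in `ρ` and monotone in `ε`. [folklore] -/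
theorem hasFineBall_mono {ρ ρ' ε ε' : ℝ} {N : ℕ} {x : Fin N → E3} (hρ : ρ' ≤ ρ) (hε : ε ≤ ε')
    (h : HasFineBall ρ ε x) : HasFineBall ρ' ε' x := by
  obtain ⟨c, t, A, hA, hN⟩ := h
  exact ⟨c, t, A, hA, near_mono hρ hε hN⟩

/-! ## (a) Load-bearing hypotheses: any proof must use MINIMALITY and LARGENESS -/

/-- `FineGrains` with the ground-state hypothesis weakened to mere injectivity. -/
def FineGrainsWithoutMinimality : Prop :=
  ∀ ρ ε : ℝ, 0 < ρ → 0 < ε → ∃ N₀ : ℕ, ∀ N : ℕ, N₀ ≤ N → ∀ x : Fin N → E3,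
    Function.Injective x → HasFineBall ρ ε x

/-- The collinear gas: `N` particles at `0, 10u, 20u, …` (`u = triangularVec₁ 1`). -/
def gas (N : ℕ) : Fin N → E3 := fun i => ((10 : ℝ) * (i : ℕ)) • (triangularVec₁ 1 : E3)

/-- The gas is injective. [folklore] -/
theorem gas_injective (N : ℕ) : Function.Injective (gas N) := by
  intro i j hij
  have hu1 : ‖(triangularVec₁ 1 : E3)‖ = 1 := norm_triangularVec₁
  have hu0 : (triangularVec₁ 1 : E3) ≠ 0 := by
    intro h0; rw [h0, norm_zero] at hu1; norm_num at hu1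
  have h1 : (10 : ℝ) * (i : ℕ) = 10 * (j : ℕ) := smul_left_injective ℝ hu0 hij
  exact Fin.ext (by exact_mod_cast (mul_left_cancel₀ (by norm_num : (10 : ℝ) ≠ 0) h1))

/-- Distinct gas particles are `≥ 10` apart. [folklore] -/
theorem gas_far (N : ℕ) {i j : Fin N} (hij : i ≠ j) : 10 ≤ dist (gas N i) (gas N j) := by
  have hu1 : ‖(triangularVec₁ 1 : E3)‖ = 1 := norm_triangularVec₁
  have hij' : (i : ℕ) ≠ (j : ℕ) := Fin.val_ne_of_ne hij
  have h1 : (1 : ℝ) ≤ |((i : ℕ) : ℝ) - ((j : ℕ) : ℝ)| := by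
    rcases Nat.lt_or_gt_of_ne hij' with hlt | hlt
    · have : ((i : ℕ) : ℝ) + 1 ≤ ((j : ℕ) : ℝ) := by exact_mod_cast hlt
      rw [abs_sub_comm]; exact le_trans (by linarith) (le_abs_self _)
    · have : ((j : ℕ) : ℝ) + 1 ≤ ((i : ℕ) : ℝ) := by exact_mod_cast hlt
      exact le_trans (by linarith) (le_abs_self _)
  have h2 : dist (gas N i) (gas N j) = 10 * |((i : ℕ) : ℝ) - ((j : ℕ) : ℝ)| := by
    change dist (((10 : ℝ) * (i : ℕ)) • (triangularVec₁ 1 : E3))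
      (((10 : ℝ) * (j : ℕ)) • (triangularVec₁ 1 : E3)) = _
    rw [dist_eq_norm, ← sub_smul, norm_smul, hu1, mul_one, ← mul_sub, Real.norm_eq_abs, abs_mul,
      abs_of_pos (by norm_num : (0 : ℝ) < 10)]
  rw [h2]; linarith

/-- **A matched ball of radius `≥ 21/10` forces a bond of length in `[189/200 − 2ε, 199/200 + 2ε]`:**
the site `t 0 + A z` within `11/10` of the centre and its neighbour `t 0 + A (z + u)` both lie in the
ball, are `‖A u‖ ∈ [189/200, 199/200]` apart, and each owns a particle within `ε`; for `ε < 189/400` the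
two particles are distinct.  Uses only clause (ii) of `Near` and `Adm` (nothing about `t 1`). [folklore] -/
theorem exists_bond_of_near {N : ℕ} {x : Fin N → E3} {c : E3} {t : Fin 2 → E3} {A : E3 →L[ℝ] E3}
    (hA : Adm A) {ρ ε : ℝ} (hρ : 21 / 10 ≤ ρ) (hε : ε < 189 / 400)
    (hN : Near (Set.range x) c ρ t A ε) :
    ∃ i j : Fin N, i ≠ j ∧ 189 / 200 - 2 * ε ≤ dist (x i) (x j) ∧ dist (x i) (x j) ≤ 199 / 200 + 2 * ε := by
  set u : E3 := triangularVec₁ 1 with hu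
  have hu1 : ‖u‖ = 1 := norm_triangularVec₁
  have hu0 : u ≠ 0 := by intro h0; rw [h0, norm_zero] at hu1; norm_num at hu1
  obtain ⟨z, hz, hzc⟩ := exists_site_near hA (t 0) c
  have hzu : z + u ∈ Lam := lam_add_mem hz triangularVec₁_mem_lam
  have hAu : ‖A u‖ ≤ 199 / 200 := by simpa [hu1] using adm_norm_le hA u
  have hAu' : 189 / 200 ≤ ‖A u‖ := by simpa [hu1] using adm_le_norm hA u
  have hd : dist (t 0 + A (z + u)) (t 0 + A z) = ‖A u‖ := by
    rw [dist_site_site]; congr 1; abel_nf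
  have hzuc : dist (t 0 + A (z + u)) c ≤ ρ := by
    calc dist (t 0 + A (z + u)) c ≤ dist (t 0 + A (z + u)) (t 0 + A z) + dist (t 0 + A z) c :=
          dist_triangle _ _ _
      _ ≤ 199 / 200 + 11 / 10 := by rw [hd]; linarith
      _ ≤ ρ := by linarith
  obtain ⟨p, ⟨i, rfl⟩, hp⟩ := hN.2 0 z hz (by linarith)
  obtain ⟨q, ⟨j, rfl⟩, hq⟩ := hN.2 0 (z + u) hzu hzuc
  refine ⟨i, j, ?_, ?_, ?_⟩
  · intro hij
    subst hij
    have hclose : dist (t 0 + A z) (t 0 + A (z + u)) ≤ ε + ε := by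
      calc _ ≤ dist (t 0 + A z) (x i) + dist (x i) (t 0 + A (z + u)) := dist_triangle _ _ _
        _ ≤ ε + ε := by rw [dist_comm]; gcongr
    rw [dist_comm, hd] at hclose
    linarith
  · have h1 : dist (t 0 + A z) (t 0 + A (z + u)) ≤ dist (t 0 + A z) (x i) + dist (x i) (x j) +
        dist (x j) (t 0 + A (z + u)) := dist_triangle4 _ _ _ _
    rw [dist_comm (t 0 + A z) (t 0 + A (z + u)), hd, dist_comm (t 0 + A z) (x i)] at h1
    linarith
  · calc dist (x i) (x j) ≤ dist (x i) (t 0 + A z) + dist (t 0 + A z) (t 0 + A (z + u)) +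
          dist (t 0 + A (z + u)) (x j) := dist_triangle4 _ _ _ _
      _ ≤ ε + 199 / 200 + ε := by
        gcongr
        · rw [dist_comm, hd]; exact hAu
        · rw [dist_comm]; exact hq
      _ = 199 / 200 + 2 * ε := by ring


/-- **No ball of radius `≥ 21/10` of the gas is two-way `ε`-matched with an admissible datum for
`ε < 189/400`:** the bond forced by `exists_bond_of_near` would be `< 10` long, but distinct gas particles
are `≥ 10` apart. [folklore] -/
theorem not_near_gas (N : ℕ) {c : E3} {t : Fin 2 → E3} {A : E3 →L[ℝ] E3} (hA : Adm A) {ρ ε : ℝ}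
    (hρ : 21 / 10 ≤ ρ) (hε : ε < 189 / 400) : ¬ Near (Set.range (gas N)) c ρ t A ε := by
  intro hN
  obtain ⟨i, j, hij, -, hle⟩ := exists_bond_of_near hA hρ hε hN
  have h10 := gas_far N hij
  linarith

/-- **`FineGrains` forces bonds near the window:** if the crux holds then for every `ε ∈ (0, 189/400)`
all large ground states contain two particles at distance in `[189/200 − 2ε, 199/200 + 2ε]` — the
cheapest necessary condition to test numerically (relaxed LJ bulk bonds are `≈ 0.971`). [folklore] -/
theorem fineGrains_forces_bonds (h : Theses.ExcessDecayLiouville.FineGrains) {ε : ℝ} (hε : 0 < ε)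
    (hε' : ε < 189 / 400) :
    ∃ N₀ : ℕ, ∀ N : ℕ, N₀ ≤ N → ∀ x : Fin N → E3, IsGroundState lennardJones x →
      ∃ i j : Fin N, i ≠ j ∧ 189 / 200 - 2 * ε ≤ dist (x i) (x j) ∧
        dist (x i) (x j) ≤ 199 / 200 + 2 * ε := by
  rw [fineGrains_iff] at h
  obtain ⟨N₀, hN₀⟩ := h (21 / 10) ε (by norm_num) hε
  refine ⟨N₀, fun N hN x hx => ?_⟩
  obtain ⟨c, t, A, hA, hNear⟩ := hN₀ N hN x hx
  exact exists_bond_of_near hA le_rfl hε' hNear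

/-- **Minimality is load-bearing**: for arbitrary injective configurations the statement fails at
`(ρ, ε) = (3, 1/40)` (the collinear gas of any size). [folklore] -/
theorem fineGrains_false_without_minimality : ¬ FineGrainsWithoutMinimality := by
  intro h
  obtain ⟨N₀, hN₀⟩ := h 3 (1 / 40) (by norm_num) (by norm_num)
  obtain ⟨c, t, A, hA, hN⟩ := hN₀ N₀ le_rfl (gas N₀) (gas_injective N₀)
  exact not_near_gas N₀ hA (by norm_num) (by norm_num) hN

/-- `FineGrains` with the largeness hypothesis `N ≥ N₀` dropped (every ground state of every size). -/
def FineGrainsWithoutLargeness : Prop :=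
  ∀ ρ ε : ℝ, 0 < ρ → 0 < ε → ∀ (N : ℕ) (x : Fin N → E3), IsGroundState lennardJones x →
    HasFineBall ρ ε x

/-- The EMPTY configuration has no matched ball of radius `≥ 11/10`, at any tolerance: the site within
`11/10` of the centre has no particle to own it. [folklore] -/
theorem not_hasFineBall_fin_zero {ρ ε : ℝ} (hρ : 11 / 10 ≤ ρ) (x : Fin 0 → E3) :
    ¬ HasFineBall ρ ε x := by
  rintro ⟨c, t, A, hA, hN⟩
  obtain ⟨z, hz, hzc⟩ := exists_site_near hA (t 0) c
  obtain ⟨p, ⟨i, _⟩, _⟩ := hN.2 0 z hz (hzc.trans hρ)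
  exact i.elim0

/-- **Largeness is load-bearing**: the empty ground state (`isGroundState_fin_zero`) refutes the
statement without `N ≥ N₀` at `(ρ, ε) = (2, 1)` — indeed at every `ρ ≥ 11/10` and EVERY `ε`. [folklore] -/
theorem fineGrains_false_without_largeness : ¬ FineGrainsWithoutLargeness := fun h =>
  not_hasFineBall_fin_zero (by norm_num : (11 : ℝ) / 10 ≤ 2) _
    (h 2 1 (by norm_num) (by norm_num) 0 (fun i => i.elim0) (isGroundState_fin_zero _))

/-! ## (a′) How large `N₀(ρ, ε)` must be: `≥ 1` from `ρ ≥ 11/10` (any `ε`), `≥ ((ρ − 11/10)/4)³` for `ε ≤ 1/40` -/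

/-- Any threshold `N₀` valid at a radius `ρ ≥ 11/10` is `≥ 1` (test on the empty ground state). [folklore] -/
theorem one_le_threshold {ρ ε : ℝ} (hρ : 11 / 10 ≤ ρ) {N₀ : ℕ}
    (h : ∀ N : ℕ, N₀ ≤ N → ∀ x : Fin N → E3, IsGroundState lennardJones x → HasFineBall ρ ε x) :
    1 ≤ N₀ := by
  rcases Nat.eq_zero_or_pos N₀ with h0 | h0
  · subst h0
    exact absurd (h 0 le_rfl (fun i => i.elim0) (isGroundState_fin_zero _))
      (not_hasFineBall_fin_zero hρ _)
  · exact h0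

/-- **`N₀(ρ, ε)` is at least cubic in `ρ`** for `ε ≤ 1/40`: a threshold valid at radius
`ρ ≥ 11/10 + 4K` satisfies `(K+1)³ ≤ N₀` (a matched ball holds `(K+1)³` sites `≥ 189/200` apart, each
owning its own particle; test on a ground state with exactly `N₀` particles,
`LennardJonesGroundStatesExist_holds`).  Reuses `CubicThreshold.cube_le_card_of_near`. [folklore] -/
theorem threshold_cubic {ρ ε : ℝ} (hε : ε ≤ 1 / 40) {N₀ : ℕ}
    (h : ∀ N : ℕ, N₀ ≤ N → ∀ x : Fin N → E3, IsGroundState lennardJones x → HasFineBall ρ ε x)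
    (K : ℕ) (hR : 11 / 10 + 4 * K ≤ ρ) : (K + 1) ^ 3 ≤ N₀ := by
  obtain ⟨x, hx⟩ := LennardJonesGroundStatesExist_holds N₀
  obtain ⟨c, t, A, hA, hN⟩ := h N₀ le_rfl x hx
  exact cube_le_card_of_near hA (near_mono le_rfl hε hN) K hR

/-! ## (c) Natural strengthenings refuted -/

/-- **No `N₀` uniform in `ρ`:** the quantifier swap `∃ N₀ ∀ ρ ε` is false (a ground state of `N₀`
particles cannot fill a matched ball of radius `11/10 + 4N₀`). [folklore] -/
theorem not_fineGrains_uniform_radius :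
    ¬ ∃ N₀ : ℕ, ∀ ρ ε : ℝ, 0 < ρ → 0 < ε → ∀ N : ℕ, N₀ ≤ N → ∀ x : Fin N → E3,
      IsGroundState lennardJones x → HasFineBall ρ ε x := by
  rintro ⟨N₀, h⟩
  have := threshold_cubic (le_refl (1 / 40 : ℝ))
    (fun N hN x hx => h (11 / 10 + 4 * N₀) (1 / 40) (by positivity) (by norm_num) N hN x hx) N₀ le_rfl
  have h1 : N₀ + 1 ≤ (N₀ + 1) ^ 3 := Nat.le_self_pow (by norm_num) _
  omega

/-- **Negative tolerance is contradictory** (so `0 < ε`, or at least `0 ≤ ε`, is needed): for `ε < 0`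
no configuration has a matched ball of radius `≥ 11/10`. [folklore] -/
theorem not_hasFineBall_of_neg {ρ ε : ℝ} (hρ : 11 / 10 ≤ ρ) (hε : ε < 0) {N : ℕ} (x : Fin N → E3) :
    ¬ HasFineBall ρ ε x := by
  rintro ⟨c, t, A, hA, hN⟩
  obtain ⟨z, hz, hzc⟩ := exists_site_near hA (t 0) c
  obtain ⟨p, _, hp⟩ := hN.2 0 z hz (hzc.trans hρ)
  exact absurd (lt_of_le_of_lt hp hε) (not_lt.2 dist_nonneg)


/-! ## (f) Normalisation of data (infrastructure for GrainsGlue / LimitGlue-type compactness)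

The site set — hence `Near` — is invariant under translating each sublattice origin by `A`(a lattice
vector) and under swapping the sublattices; so a matched datum can always be normalised to have both
origins within the covering radius `11/10` of the centre of the ball (bounded data ⇒ compactness). -/

/-- Translating each sublattice origin by the image of a lattice vector does not change the site set,
hence not the matching. [folklore] -/
theorem near_translate {X : Set E3} {c : E3} {r ε : ℝ} {t : Fin 2 → E3} {A : E3 →L[ℝ] E3}
    (z₀ : Fin 2 → E3) (hz₀ : ∀ m, z₀ m ∈ Lam) (h : Near X c r t A ε) :
    Near X c r (fun m => t m + A (z₀ m)) A ε := by
  refine ⟨fun p hp hpc => ?_, fun m z hz hzc => ?_⟩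
  · obtain ⟨m, z, hz, hd⟩ := h.1 p hp hpc
    refine ⟨m, z - z₀ m, lam_sub_mem hz (hz₀ m), ?_⟩
    have e : t m + A (z₀ m) + A (z - z₀ m) = t m + A z := by rw [map_sub]; abel
    simpa only [e] using hd
  · have e : t m + A (z₀ m) + A z = t m + A (z₀ m + z) := by rw [map_add]; abel
    rw [e] at hzc ⊢
    exact h.2 m (z₀ m + z) (lam_add_mem (hz₀ m) hz) hzc

/-- Swapping the two sublattices does not change the site set, hence not the matching. [folklore] -/
theorem near_swap {X : Set E3} {c : E3} {r ε : ℝ} {t : Fin 2 → E3} {A : E3 →L[ℝ] E3}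
    (h : Near X c r t A ε) : Near X c r ![t 1, t 0] A ε := by
  have hm : ∀ n : Fin 2, n = 0 ∨ n = 1 := by
    intro n
    rcases n with ⟨_ | _ | n, hn⟩
    · exact Or.inl rfl
    · exact Or.inr rfl
    · omega
  have h0 : (![t 1, t 0] : Fin 2 → E3) 0 = t 1 := by simp
  have h1 : (![t 1, t 0] : Fin 2 → E3) 1 = t 0 := by simp
  refine ⟨fun p hp hpc => ?_, fun m z hz hzc => ?_⟩
  · obtain ⟨m, z, hz, hd⟩ := h.1 p hp hpc
    rcases hm m with rfl | rfl
    · exact ⟨1, z, hz, by rw [h1]; exact hd⟩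
    · exact ⟨0, z, hz, by rw [h0]; exact hd⟩
  · rcases hm m with rfl | rfl
    · rw [h0] at hzc ⊢; exact h.2 1 z hz hzc
    · rw [h1] at hzc ⊢; exact h.2 0 z hz hzc

/-- **Normalisation of data** (for compactness arguments): a matched datum may be replaced by one with
the same cell whose two sublattice origins lie within `11/10` of the centre of the ball. [folklore] -/
theorem near_normalise {X : Set E3} {c : E3} {r ε : ℝ} {t : Fin 2 → E3} {A : E3 →L[ℝ] E3}
    (hA : Adm A) (h : Near X c r t A ε) :
    ∃ t' : Fin 2 → E3, (∀ m, dist (t' m) c ≤ 11 / 10) ∧ Near X c r t' A ε := by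
  have hz : ∀ m : Fin 2, ∃ z ∈ Lam, dist (t m + A z) c ≤ 11 / 10 := fun m => exists_site_near hA (t m) c
  choose z₀ hz₀ hd using hz
  exact ⟨fun m => t m + A (z₀ m), hd, near_translate z₀ hz₀ h⟩


end Summit.AtomisticToContinuum.Crystallization.Theorems.FineGrains.Negative.LoadBearing

end
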